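import Mathlib
import Summits.QuantumFields.YangMills.Theorems.CoarseStiffnessTailCappedCoarseStiffnessLBareStiffnessOfMeanAction

/-!
# Route `CoarseStiffnessTail` — THE BARE FACE OF THE CRUX IS THE UNIFORM MEAN-PLAQUETTE BOUND: at `j = 0` the cap, the window and
# the profile are idle (lead's certificate, seat `ym-line-cst-p1` g12; helper on stmt-QuantumFields-25301; part 3 of 3 — the dictionary;
# parts 1–2: `…CappedCoarseStiffnessLPressureConvexity` (p652852), `…CappedCoarseStiffnessLBareStiffnessOfMeanAction` (p653215))

THE ITEM.  Crux `CoarseStiffnessTail.CappedCoarseStiffnessL` (stmt-QuantumFields-25301, XL, OPEN): for every `L, b₀, p₀` there are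
`c₀ > 0, C₀, γ₁ ∈ (0,1]` such that for every family `F` (`F.L = L`), every `0 < γ ≤ γ₁`, every cut-off `K` and height `j ≤ K`,
`∫ exp(c₀·β_{K−j}·Σ_{a ∈ Plaq_j} min(|Ū^j(∂a) − 1|², θ(K−j)²)) dGibbs_K ≤ exp(C₀·#Plaq_j)`.  The registered skeleton v5
(`Cruxes/CappedCoarseStiffnessL/Lines/birth.lean`) factorises it as EDGE (`stub_uniformLargeFieldCountPos`, heights `j ≥ 1`; the height
`j = 0` is the theorem `CoarseStiffnessTailBareUniformCount.bare_uniformLargeFieldCount`) ∧ BULK (`stub_subThresholdStiffness`), and the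
line card (§g2, §g8, §g9) located the ONLY non-elementary content of the item at the finest height `j = 0` inside the BULK stub: «the
γ-uniform bare rung = a uniform Laplace-exponent statement for the Wilson action on the torus (flat-connection zero modes)» — a recon, no Lean.

THIS CERTIFICATE (three definition-free files; every statement written out in the crux's own quantifier format) puts that bare content in
CLASSICAL LETTERS and proves it is ALL of the bare content; this part assembles the dictionary from parts 1–2.  Write, for a family `F`, coupling `γ` and cut-off `K` (finest torus `2L^{m+K}` sites per direction,
`β_K = (γL^{−K})⁻¹`, `Gibbs_K` the Wilson law `T3UnitScaleTilt.gibbsK F ℰp γ K`, `A(U) = Σ_p (1 − Re tr U(∂p))` the Wilson action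
`wilsonAction4`, `#Plaq_0` the number of plaquettes):

* UMA  («uniform mean action»)      `∀ L ∃ C γ₁ ∀ F γ K:  β_K·∫ Σ_a |U(∂a) − 1|² dGibbs_K ≤ C·#Plaq_0`;
* UMWA (Wilson letters)             `∀ L ∃ C γ₁ ∀ F γ K:  β_K·∫ A dGibbs_K ≤ C·#Plaq_0` — mean plaquette energy `O(1/β_K)`;
* UBS  («uncapped bare stiffness»)  `∀ L ∃ c₀ C₀ γ₁ ∀ F γ K:  ∫ exp(c₀β_K·Σ_a|U(∂a) − 1|²) dGibbs_K ≤ exp(C₀·#Plaq_0)`;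
* CRUX₀ = the typed crux at `j = 0` (capped tilt `min(|U(∂a) − 1|², θ(K)²)`, every profile `(b₀, p₀)`);
* BULK₀ = the registered BULK stub at `j = 0` (sub-threshold tilt `|U(∂a) − 1|²·1[|U(∂a) − 1| < θ(K)]`, every profile).

THE THEOREMS.
* ★ `crux0_iff_uma`, `bulk0_iff_uma`, `ubs_iff_uma`, `crux0_iff_bulk0` (with part 1's `uma_iff_umwa`):  **CRUX₀ ⇔ BULK₀ ⇔ UBS ⇔ UMA ⇔ UMWA** — at the
  finest height the cap, the small-field window and the profile `(b₀, p₀)` are IDLE: the bare face of the item is exactly «the mean plaquette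
  energy of the Wilson law on Bałaban's tori is `O(1/β)`, uniformly in the volume exponent `m`, the cut-off `K` and the coupling `γ ≤ γ₁`»;
* ★ `uma_of_cappedCoarseStiffnessL`, `meanWilsonAction_of_cappedCoarseStiffnessL`: the TYPED crux implies UMA / UMWA (a necessary
  condition anyone can read); `uma_of_subThresholdStiffness`: so does the registered BULK stub (verbatim as hypothesis).
MECHANISM (all elementary; parts 1–2).  (⇐, part 1 §3) `Σ|U(∂a) − 1|² ≤ 4A` on `SU(2)` (tree (11)); the exponential moment of the action is a ratio of
partition functions, `∫e^{tA}dGibbs_β = Z(β − t)/Z(β)` (`integral_exp_mul_action_eq`), and CONVEXITY OF THE PRESSURE in ratio form,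
`Z(β − t)/Z(β) ≤ exp(t·⟨A⟩_{β−t})` (`partitionFn_sub_div_le_exp`: Jensen `∫e^{−tA}dGibbs_{β−t} ≥ e^{−t⟨A⟩_{β−t}}`, no differentiation),
at `t = β_K/2`, where `Gibbs` at `β_K/2` on the cut-off-`K` torus IS `Gibbs_K` at coupling `2γ` (`scheme_β_two_mul`) and `A ≤ ½Σ|U(∂a) − 1|²`
(tree (0.14)) — so UMA at `2γ` bounds the uncapped tilt at `γ` (`ubs_of_uma`: `c₀ = 1/8`, `C₀ = max C 0/2`, `γ₁/2`); UBS dominates CRUX₀ and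
BULK₀ pointwise (part 2 §4).  (⇒, part 2 §5) below the window edge JENSEN (`integral_le_log_integral_exp`: `c₀β_K∫X ≤ log∫e^{c₀β_KX} ≤ C₀#Plaq_0` at the
profile `(1, 3)`); above it `|U(∂a) − 1|² ≤ 4` and the LANDED joint Peierls–chessboard bound of g9 (`jointPeierls_bare`, one plaquette:
`Gibbs_K{θ(K) ≤ |U(∂a) − 1|} ≤ e^{−p(g_K)²/24}`) with `p(g_K)² ≥ 36·log β_K` for `γ ≤ e^{−144}` (`sq_pFun_ge`) pays the one power of `β_K`
(`beta_mul_exp_neg_profile_le_one`; engine `mean_sqSum_le_of_tilt`).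

WHAT IT SAYS (for planners / director / instrument; no claim about Bałaban's estimates).
* The line card's g2 recon is now a kernel statement with a classical name: the `j = 0` face of the BULK stub (= of the typed item, since EDGE₀
  is a theorem) is EQUIVALENT to UMA; nothing about thresholds, tilts or windows survives at the bare level.  UMA is a property of the plain
  Wilson law: `⟨1 − ½Re Tr U(∂p)⟩_{Λ,β} ≤ C/β` averaged over the plaquettes of `Λ = (ℤ/2L^{m+K}ℤ)³`, for ALL `m, K` and ALL `β = L^K/γ ≥ L^K/γ₁`.
* STATUS OF UMA (presearch g12).  Per lattice it is true (`β⟨A⟩_β` tends to the Laplace exponent of `A`, `≤ (3/2)·#bonds`); in the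
  thermodynamic limit on BOXES it follows from the leading-term free-energy theorem [corpus: paper:arxiv-1602.01222 (Chatterjee 2016), restated
  as Thm 1 of paper:arxiv-2511.07297 (Brennecke 2025): `F_{n,g} = (|E¹_n|/2n^d)N²log g² + … + o(1)`, `o(1) → 0` as `n → ∞, g → 0`
  independently; free b.c., `U(N)`] and from the exact-Gaussian-volume sandwich of [corpus: paper:arxiv-1903.09829 (O'Carroll–Faria da Veiga),
  free b.c.] through `(1 − κ⁻¹)·β⟨A⟩_β ≤ log Z(β/κ) − log Z(β)`; on Bałaban's TORI, uniformly in volume AND `β`, it is NOT in print (corpus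
  fts+vec, galaxy pdf: nothing): the tree-gauge sandwich (§g2 of the card) gives `β_K⟨A⟩ ≤ C·#Plaq_0 + (9/2)·log β_K`, i.e. UMA for
  `log β_K ≲ #Plaq_0`, and the residual regime `log β_K ≫ #Plaq_0` is the uniform Laplace exponent `(3D − 5)/2` of the torus (commuting-triple
  zero modes) — where every loss polynomial in the volume is free and only the exponent of `β` must be exact.  So BULK₀ is «true, classical,
  unprinted in its uniform form, read by no consumer of the line» — consistent with the standing recommendation (re-type 25301 to the EDGE).
* Instrument cross-reading: UMA's quantity `β_K⟨Σdist1²⟩/#Plaq_0` is the untilted `c = 0`, `j = 0` column of JOB A / JOB F (a method-check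
  row there), the equipartition value at weak coupling; nothing to test.

HONEST SCOPE.  Compact-group arithmetic, Jensen and the Gibbs variational sandwich, composed by name with two landed certificates (g9's joint
Peierls bound, tree (11)/(0.14)).  Nothing of Bałaban's (5)/(70)/(71) is proved; UMA itself is NOT proved here (only per-`(F,γ)`-truncated forms
exist in the tree: `CoarseStiffnessTailBareLogStiffness.bare_logStiffness`); the crux 25301, both registered stubs at `j ≥ 1`, `HistoryTailL`
19936 stay OPEN; no rung, leaf or summit is proved — `YM3TorusSU2` (R3, RECORD rung, not Clay) is NOT proved; the Yang–Mills mass gap is NOT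
touched.

References: T. Bałaban, CMP **102** (1985) 255–275 [Balaban1985UV3] ((1)–(3) p.256 scaled Wilson laws; (5) p.256; (7) p.257 `p(g)`; (11) p.258;
(71) p.273); T. Bałaban, CMP **109** (1987) 249–301 [Balaban1987RG1] ((0.14) p.254); J. Fröhlich, R. Israel, E. H. Lieb, B. Simon, CMP **62**
(1978) 1–34 [FrohlichIsraelLiebSimon1978] (chessboard, behind `jointPeierls_bare`); S. Chatterjee, J. Funct. Anal. **271** (2016)
[arXiv:1602.01222]; C. Brennecke, J. Stat. Phys. (2026) [arXiv:2511.07297]; M. O'Carroll, P. A. Faria da Veiga [arXiv:1903.09829] (context only,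
nothing of theirs is used).
-/

noncomputable section

namespace Summit.QuantumFields.YangMills.Theorems.CoarseStiffnessTailMeanAction

open MeasureTheory ProbabilityTheory Finset
open Literature.MathematicalPhysics.QuantumFieldTheory
open Literature.MathematicalPhysics.QuantumFieldTheory.Balaban1983to89
open Literature.MathematicalPhysics.QuantumFieldTheory.Balaban1983to89.T3ContinuumYM3Torus
open Literature.MathematicalPhysics.QuantumFieldTheory.Balaban1983to89.T3UnitScaleTilt
open Literature.MathematicalPhysics.QuantumFieldTheory.Balaban1983to89.T3UnitLawDensityEML
open Literature.MathematicalPhysics.QuantumFieldTheory.Balaban1983to89.Missing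
open Literature.MathematicalPhysics.QuantumFieldTheory.Balaban1983to89.T4StabilityFloorUnitary
  (one_sub_reTr_le_half_dist1_sq_specialUnitary wilsonAction4_eq_sum)
open Literature.MathematicalPhysics.QuantumFieldTheory.Balaban1983to89.B10Eq71TorusLocal (dist1_sq_le_specialUnitaryGroup)
open Literature.MathematicalPhysics.QuantumFieldTheory.Balaban1983to89.T4PairDerivBridge (dist1_le_two_specialUnitaryGroup)
open Summit.QuantumFields.YangMills.Theorems.CoarseStiffnessTailBareUniformCount (jointPeierls_bare sq_pFun_ge coupling_facts)
open Summit.QuantumFields.YangMills.Theorems.CoarseStiffnessTailPressureConvexity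
open Summit.QuantumFields.YangMills.Theorems.CoarseStiffnessTailBareStiffnessOfMeanAction

/-! ## §6 (numbering continued from parts 1–2) The dictionary: at the bare level the cap, the window and the profile are idle — crux₀ ⇔ BULK₀ ⇔ uncapped stiffness ⇔
uniform mean action ⇔ uniform mean Wilson action; and the typed crux / the registered BULK stub imply them -/

section Dictionary

/-- **CRUX₀ ⇔ UNIFORM MEAN ACTION**: the `j = 0` face of `CappedCoarseStiffnessL` (capped tilt, every profile, constants before `(F, γ, K)`)
holds iff `β_K·E_K Σ_a|U(∂a) − 1|² = O(#Plaq_0)` uniformly in the family, the cut-off and `γ ≤ γ₁`. [cite: Balaban1985UV3, (7) p.257 and (71) p.273] -/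
theorem crux0_iff_uma :
    (∀ (L : ℕ) (b₀ p₀ : ℝ), 0 < b₀ → 2 < p₀ → ∃ (c₀ C₀ γ₁ : ℝ), 0 < c₀ ∧ 0 < γ₁ ∧ γ₁ ≤ 1 ∧
      ∀ (F : T3Family) (γ : ℝ), F.L = L → 0 < γ → γ ≤ γ₁ → ∀ (K : ℕ),
        ∫ U, Real.exp (c₀ * (γ * ((F.L : ℝ)⁻¹) ^ K)⁻¹ *
            ∑ a : Plaq (F.P K) 0, min (dist1 (GaugeField.plaqHol U a) ^ 2) (θBal F.L γ b₀ p₀ K ^ 2)) ∂(gibbsK F ℰp γ K) ≤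
          Real.exp (C₀ * (Fintype.card (Plaq (F.P K) 0) : ℝ))) ↔
    (∀ (L : ℕ), ∃ (C γ₁ : ℝ), 0 < γ₁ ∧ γ₁ ≤ 1 ∧ ∀ (F : T3Family) (γ : ℝ), F.L = L → 0 < γ → γ ≤ γ₁ → ∀ (K : ℕ),
      (γ * ((F.L : ℝ)⁻¹) ^ K)⁻¹ * ∫ U, (∑ a : Plaq (F.P K) 0, dist1 (GaugeField.plaqHol U a) ^ 2) ∂(gibbsK F ℰp γ K) ≤
        C * (Fintype.card (Plaq (F.P K) 0) : ℝ)) :=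
  ⟨uma_of_crux0, fun h => crux0_of_ubs (ubs_of_uma h)⟩

/-- **BULK₀ ⇔ UNIFORM MEAN ACTION**: the `j = 0` face of the registered BULK stub `stub_subThresholdStiffness` holds iff the uniform
mean-action bound holds. [cite: Balaban1985UV3, (5) p.256 and (7) p.257] -/
theorem bulk0_iff_uma :
    (∀ (L : ℕ) (b₀ p₀ : ℝ), 0 < b₀ → 2 < p₀ → ∃ (c₀ C₀ γ₁ : ℝ), 0 < c₀ ∧ 0 < γ₁ ∧ γ₁ ≤ 1 ∧
      ∀ (F : T3Family) (γ : ℝ), F.L = L → 0 < γ → γ ≤ γ₁ → ∀ (K : ℕ),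
        ∫ U, Real.exp (c₀ * (γ * ((F.L : ℝ)⁻¹) ^ K)⁻¹ *
            ∑ a : Plaq (F.P K) 0, (if dist1 (GaugeField.plaqHol U a) < θBal F.L γ b₀ p₀ K then
              dist1 (GaugeField.plaqHol U a) ^ 2 else 0)) ∂(gibbsK F ℰp γ K) ≤
          Real.exp (C₀ * (Fintype.card (Plaq (F.P K) 0) : ℝ))) ↔
    (∀ (L : ℕ), ∃ (C γ₁ : ℝ), 0 < γ₁ ∧ γ₁ ≤ 1 ∧ ∀ (F : T3Family) (γ : ℝ), F.L = L → 0 < γ → γ ≤ γ₁ → ∀ (K : ℕ),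
      (γ * ((F.L : ℝ)⁻¹) ^ K)⁻¹ * ∫ U, (∑ a : Plaq (F.P K) 0, dist1 (GaugeField.plaqHol U a) ^ 2) ∂(gibbsK F ℰp γ K) ≤
        C * (Fintype.card (Plaq (F.P K) 0) : ℝ)) :=
  ⟨uma_of_bulk0, fun h => bulk0_of_ubs (ubs_of_uma h)⟩

/-- **UNCAPPED BARE STIFFNESS ⇔ UNIFORM MEAN ACTION** (part 1 §3, part 2 §4–§5). [cite: Balaban1985UV3, (1)-(3) p.256] -/
theorem ubs_iff_uma :
    (∀ (L : ℕ), ∃ (c₀ C₀ γ₁ : ℝ), 0 < c₀ ∧ 0 < γ₁ ∧ γ₁ ≤ 1 ∧ ∀ (F : T3Family) (γ : ℝ), F.L = L → 0 < γ → γ ≤ γ₁ → ∀ (K : ℕ),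
      ∫ U, Real.exp (c₀ * (γ * ((F.L : ℝ)⁻¹) ^ K)⁻¹ * ∑ a : Plaq (F.P K) 0, dist1 (GaugeField.plaqHol U a) ^ 2)
          ∂(gibbsK F ℰp γ K) ≤ Real.exp (C₀ * (Fintype.card (Plaq (F.P K) 0) : ℝ))) ↔
    (∀ (L : ℕ), ∃ (C γ₁ : ℝ), 0 < γ₁ ∧ γ₁ ≤ 1 ∧ ∀ (F : T3Family) (γ : ℝ), F.L = L → 0 < γ → γ ≤ γ₁ → ∀ (K : ℕ),
      (γ * ((F.L : ℝ)⁻¹) ^ K)⁻¹ * ∫ U, (∑ a : Plaq (F.P K) 0, dist1 (GaugeField.plaqHol U a) ^ 2) ∂(gibbsK F ℰp γ K) ≤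
        C * (Fintype.card (Plaq (F.P K) 0) : ℝ)) :=
  ⟨fun h => uma_of_crux0 (crux0_of_ubs h), ubs_of_uma⟩

/-- **CRUX₀ ⇔ BULK₀**: at the finest height the capped and the sub-threshold tilts have `O(1)` free energy per plaquette together or not
at all (both ⇔ the uniform mean action). [cite: Balaban1985UV3, (5) p.256 and (71) p.273] -/
theorem crux0_iff_bulk0 :
    (∀ (L : ℕ) (b₀ p₀ : ℝ), 0 < b₀ → 2 < p₀ → ∃ (c₀ C₀ γ₁ : ℝ), 0 < c₀ ∧ 0 < γ₁ ∧ γ₁ ≤ 1 ∧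
      ∀ (F : T3Family) (γ : ℝ), F.L = L → 0 < γ → γ ≤ γ₁ → ∀ (K : ℕ),
        ∫ U, Real.exp (c₀ * (γ * ((F.L : ℝ)⁻¹) ^ K)⁻¹ *
            ∑ a : Plaq (F.P K) 0, min (dist1 (GaugeField.plaqHol U a) ^ 2) (θBal F.L γ b₀ p₀ K ^ 2)) ∂(gibbsK F ℰp γ K) ≤
          Real.exp (C₀ * (Fintype.card (Plaq (F.P K) 0) : ℝ))) ↔
    (∀ (L : ℕ) (b₀ p₀ : ℝ), 0 < b₀ → 2 < p₀ → ∃ (c₀ C₀ γ₁ : ℝ), 0 < c₀ ∧ 0 < γ₁ ∧ γ₁ ≤ 1 ∧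
      ∀ (F : T3Family) (γ : ℝ), F.L = L → 0 < γ → γ ≤ γ₁ → ∀ (K : ℕ),
        ∫ U, Real.exp (c₀ * (γ * ((F.L : ℝ)⁻¹) ^ K)⁻¹ *
            ∑ a : Plaq (F.P K) 0, (if dist1 (GaugeField.plaqHol U a) < θBal F.L γ b₀ p₀ K then
              dist1 (GaugeField.plaqHol U a) ^ 2 else 0)) ∂(gibbsK F ℰp γ K) ≤
          Real.exp (C₀ * (Fintype.card (Plaq (F.P K) 0) : ℝ))) :=
  crux0_iff_uma.trans bulk0_iff_uma.symm

/-- **THE TYPED CRUX ⇒ ITS `j = 0` FACE** (specialise the height `j := 0`; `K − 0 = K`, `Ū^0 = U` definitionally). [cite: Balaban1985UV3, (7) p.257] -/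
theorem crux0_of_cappedCoarseStiffnessL (h : Summit.QuantumFields.YangMills.Theses.CoarseStiffnessTail.CappedCoarseStiffnessL) :
    ∀ (L : ℕ) (b₀ p₀ : ℝ), 0 < b₀ → 2 < p₀ → ∃ (c₀ C₀ γ₁ : ℝ), 0 < c₀ ∧ 0 < γ₁ ∧ γ₁ ≤ 1 ∧
      ∀ (F : T3Family) (γ : ℝ), F.L = L → 0 < γ → γ ≤ γ₁ → ∀ (K : ℕ),
        ∫ U, Real.exp (c₀ * (γ * ((F.L : ℝ)⁻¹) ^ K)⁻¹ *
            ∑ a : Plaq (F.P K) 0, min (dist1 (GaugeField.plaqHol U a) ^ 2) (θBal F.L γ b₀ p₀ K ^ 2)) ∂(gibbsK F ℰp γ K) ≤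
          Real.exp (C₀ * (Fintype.card (Plaq (F.P K) 0) : ℝ)) := by
  intro L b₀ p₀ hb hp
  obtain ⟨c₀, C₀, γ₁, hc, hγ, hγ1, h'⟩ := h L b₀ p₀ hb hp
  refine ⟨c₀, C₀, γ₁, hc, hγ, hγ1, fun F γ hL hγ' hγ1' K => ?_⟩
  have h0 := h' F γ hL hγ' hγ1' K 0 (Nat.zero_le K)
  simpa only [Nat.sub_zero, iter_zero] using h0

/-- **THE REGISTERED BULK STUB ⇒ ITS `j = 0` FACE** (the statement of `stub_subThresholdStiffness` of skeleton v5, verbatim, as hypothesis;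
specialise `j := 0`). [cite: Balaban1985UV3, (5) p.256] -/
theorem bulk0_of_subThresholdStiffness
    (h : ∀ (L : ℕ) (b₀ p₀ : ℝ), 0 < b₀ → 2 < p₀ → ∃ (c₀ C₀ γ₁ : ℝ), 0 < c₀ ∧ 0 < γ₁ ∧ γ₁ ≤ 1 ∧
      ∀ (F : T3Family) (γ : ℝ), F.L = L → 0 < γ → γ ≤ γ₁ → ∀ (K j : ℕ), j ≤ K →
        ∫ U, Real.exp (c₀ * (γ * ((F.L : ℝ)⁻¹) ^ (K - j))⁻¹ *
            ∑ a : Plaq (F.P K) j, (if GaugeGroup.dist1 (GaugeField.plaqHol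
              (Averaging.iter (fun i => BlockAveraging.blockAvg (P := F.P K) (j := i) T3UnitLawDensityEML.ℰp) j U) a) <
                T3UnitScaleTilt.θBal F.L γ b₀ p₀ (K - j) then
              GaugeGroup.dist1 (GaugeField.plaqHol
                (Averaging.iter (fun i => BlockAveraging.blockAvg (P := F.P K) (j := i) T3UnitLawDensityEML.ℰp) j U) a) ^ 2 else 0))
            ∂(T3UnitScaleTilt.gibbsK F T3UnitLawDensityEML.ℰp γ K) ≤
          Real.exp (C₀ * (Fintype.card (Plaq (F.P K) j) : ℝ))) :
    ∀ (L : ℕ) (b₀ p₀ : ℝ), 0 < b₀ → 2 < p₀ → ∃ (c₀ C₀ γ₁ : ℝ), 0 < c₀ ∧ 0 < γ₁ ∧ γ₁ ≤ 1 ∧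
      ∀ (F : T3Family) (γ : ℝ), F.L = L → 0 < γ → γ ≤ γ₁ → ∀ (K : ℕ),
        ∫ U, Real.exp (c₀ * (γ * ((F.L : ℝ)⁻¹) ^ K)⁻¹ *
            ∑ a : Plaq (F.P K) 0, (if dist1 (GaugeField.plaqHol U a) < θBal F.L γ b₀ p₀ K then
              dist1 (GaugeField.plaqHol U a) ^ 2 else 0)) ∂(gibbsK F ℰp γ K) ≤
          Real.exp (C₀ * (Fintype.card (Plaq (F.P K) 0) : ℝ)) := by
  intro L b₀ p₀ hb hp
  obtain ⟨c₀, C₀, γ₁, hc, hγ, hγ1, h'⟩ := h L b₀ p₀ hb hp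
  refine ⟨c₀, C₀, γ₁, hc, hγ, hγ1, fun F γ hL hγ' hγ1' K => ?_⟩
  have h0 := h' F γ hL hγ' hγ1' K 0 (Nat.zero_le K)
  simpa only [Nat.sub_zero, iter_zero] using h0

/-- ★ **THE TYPED CRUX IMPLIES THE UNIFORM MEAN-ACTION BOUND**: `CappedCoarseStiffnessL` (stmt-QuantumFields-25301) ⇒ for every block size
there are `C, γ₁` with `β_K·∫Σ_a|U(∂a) − 1|² dGibbs_K ≤ C·#Plaq_0` for every family `F` (`F.L = L`, every volume exponent `m`), every
`0 < γ ≤ γ₁` and every cut-off `K` — a NECESSARY condition of the item in the most classical currency. [cite: Balaban1985UV3, (7) p.257 and (71) p.273] -/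
theorem uma_of_cappedCoarseStiffnessL (h : Summit.QuantumFields.YangMills.Theses.CoarseStiffnessTail.CappedCoarseStiffnessL) :
    ∀ (L : ℕ), ∃ (C γ₁ : ℝ), 0 < γ₁ ∧ γ₁ ≤ 1 ∧ ∀ (F : T3Family) (γ : ℝ), F.L = L → 0 < γ → γ ≤ γ₁ → ∀ (K : ℕ),
      (γ * ((F.L : ℝ)⁻¹) ^ K)⁻¹ * ∫ U, (∑ a : Plaq (F.P K) 0, dist1 (GaugeField.plaqHol U a) ^ 2) ∂(gibbsK F ℰp γ K) ≤
        C * (Fintype.card (Plaq (F.P K) 0) : ℝ) :=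
  uma_of_crux0 (crux0_of_cappedCoarseStiffnessL h)

/-- ★ **THE TYPED CRUX IMPLIES THE UNIFORM MEAN-PLAQUETTE BOUND, WILSON LETTERS**: `CappedCoarseStiffnessL` ⇒ `β_K·⟨A⟩_{Gibbs_K} ≤ C·#Plaq_0`
(`A = Σ_p (1 − ½Re Tr U(∂p))`, the Wilson action of Bałaban's cut-off-`K` law at `β_K = (γL^{−K})⁻¹` on the torus with `2L^{m+K}` sites per
direction), uniformly in `m`, `K` and `0 < γ ≤ γ₁(L)`: the mean plaquette energy is `O(1/β)` on ALL of Bałaban's tori at ALL weak couplings.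
[cite: Balaban1985UV3, (1)-(3) p.256 and (11) p.258] -/
theorem meanWilsonAction_of_cappedCoarseStiffnessL
    (h : Summit.QuantumFields.YangMills.Theses.CoarseStiffnessTail.CappedCoarseStiffnessL) :
    ∀ (L : ℕ), ∃ (C γ₁ : ℝ), 0 < γ₁ ∧ γ₁ ≤ 1 ∧ ∀ (F : T3Family) (γ : ℝ), F.L = L → 0 < γ → γ ≤ γ₁ → ∀ (K : ℕ),
      (γ * ((F.L : ℝ)⁻¹) ^ K)⁻¹ * ∫ U, wilsonAction4 U ∂(gibbsK F ℰp γ K) ≤ C * (Fintype.card (Plaq (F.P K) 0) : ℝ) :=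
  uma_iff_umwa.mp (uma_of_cappedCoarseStiffnessL h)

/-- **THE REGISTERED BULK STUB IMPLIES THE UNIFORM MEAN-ACTION BOUND** (its `j = 0` face already does, and conversely the uniform mean action
gives back exactly that face: `bulk0_iff_uma`). [cite: Balaban1985UV3, (5) p.256] -/
theorem uma_of_subThresholdStiffness
    (h : ∀ (L : ℕ) (b₀ p₀ : ℝ), 0 < b₀ → 2 < p₀ → ∃ (c₀ C₀ γ₁ : ℝ), 0 < c₀ ∧ 0 < γ₁ ∧ γ₁ ≤ 1 ∧
      ∀ (F : T3Family) (γ : ℝ), F.L = L → 0 < γ → γ ≤ γ₁ → ∀ (K j : ℕ), j ≤ K →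
        ∫ U, Real.exp (c₀ * (γ * ((F.L : ℝ)⁻¹) ^ (K - j))⁻¹ *
            ∑ a : Plaq (F.P K) j, (if GaugeGroup.dist1 (GaugeField.plaqHol
              (Averaging.iter (fun i => BlockAveraging.blockAvg (P := F.P K) (j := i) T3UnitLawDensityEML.ℰp) j U) a) <
                T3UnitScaleTilt.θBal F.L γ b₀ p₀ (K - j) then
              GaugeGroup.dist1 (GaugeField.plaqHol
                (Averaging.iter (fun i => BlockAveraging.blockAvg (P := F.P K) (j := i) T3UnitLawDensityEML.ℰp) j U) a) ^ 2 else 0))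
            ∂(T3UnitScaleTilt.gibbsK F T3UnitLawDensityEML.ℰp γ K) ≤
          Real.exp (C₀ * (Fintype.card (Plaq (F.P K) j) : ℝ))) :
    ∀ (L : ℕ), ∃ (C γ₁ : ℝ), 0 < γ₁ ∧ γ₁ ≤ 1 ∧ ∀ (F : T3Family) (γ : ℝ), F.L = L → 0 < γ → γ ≤ γ₁ → ∀ (K : ℕ),
      (γ * ((F.L : ℝ)⁻¹) ^ K)⁻¹ * ∫ U, (∑ a : Plaq (F.P K) 0, dist1 (GaugeField.plaqHol U a) ^ 2) ∂(gibbsK F ℰp γ K) ≤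
        C * (Fintype.card (Plaq (F.P K) 0) : ℝ) :=
  uma_of_bulk0 (bulk0_of_subThresholdStiffness h)

end Dictionary

end Summit.QuantumFields.YangMills.Theorems.CoarseStiffnessTailMeanAction

end
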